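import Literature.AnabelianGeometry.SemiGraphs.ThetaRayEstranged
import Literature.AnabelianGeometry.SemiGraphs.ThetaRayElevated
import Literature.AnabelianGeometry.SemiGraphs.FreeProPRankTwo
import Literature.AnabelianGeometry.SemiGraphs.FreeProPRankTwoGluing
import Literature.AnabelianGeometry.SemiGraphs.FreeProPTwoSlimMalnormal
import Literature.AnabelianGeometry.SemiGraphs.FreeProPTwoEstrangementByAbelianisation
import Literature.GroupTheory.ProcyclicImageBridges
import HarnessLib

/-!
# (H3) + (H6) DISCHARGED at the free pro-`p` model of `𝒢_θ` — binder form over the gluing `α` and the twists `θ`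

S. Mochizuki, *Semi-graphs of anabelioids*, Publ. RIMS **42** (2006), Def. 2.4 (i) p. 25 («elevated»),
Def. 2.4 (iv) p. 26 («aloof», «estranged»), for the concrete countermodel candidate
`𝒢_θ = thetaRayOfTwists F̂₂⁽ᵖ⁾ ℤ_p α θ n` of abc-iut-L3-d1 (memo 8b26b5199c29f55f §1): vertex groups the free
pro-`p` group of rank two `F̂₂⁽ᵖ⁾ = FreeProPRankTwo.Grp p` (brick R1, `a`, `b`, continuous abelianisation
`ab : F̂₂⁽ᵖ⁾ → ℤ_p × ℤ_p` with `ab a = (1,0)`, `ab b = (0,1)`), edge groups `ℤ_p` (as `Multiplicative ℤ_[p]`),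
upper gluing `α : ℤ_p → F̂₂⁽ᵖ⁾` with `α(1) = a`, lower gluings `θ_{n_k} ∘ α` for continuous endomorphisms `θ_m`
with `θ_m(a) = a·b^{p^m}` (bricks R1c / R1 part 2 supply `α`, `θ` as TERMS; here they are BINDERS with exactly
these two equations — `θ_m(b) = b` is NOT needed for (H3)/(H6)).

This PROOF-ONLY file (0 defs) closes the three hypothesis binders `hTE` / `hTA` / `hTEs` of
`thetaRayOfTwists_thm37Hypotheses` (`ThetaRayGraphHypotheses.lean`, brick R3) at that model from LANDED
theorems only:
* `ab_α`, `ab_θ_α` — by density of `ℤ` in `ℤ_p` (`PadicInt.topologicalClosure_zpowers_ofAdd_one`) and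
  uniqueness of continuous homomorphisms out of `ℤ_p` (`ext_of_apply_ofAdd_one`): `ab (α t) = (t, 0)` and
  `ab (θ_m (α t)) = (t, p^m·t)`;
* `thetaRayFreeProP_isTotallyElevated` — (H6) via `thetaRayOfTwists_isTotallyElevated` (`ThetaRayElevated`,
  abelian `(ℤ/p^s)²` approximators, NO Lazard) with `ab` surjective by
  `surjective_of_ofAdd_one_zero_mem_of_ofAdd_zero_one_mem` (`ab_a`, `ab_b`), `εE := id`, `c_k := p^{n_k}`;
* `thetaRayFreeProP_isTotallyEstranged_and_isTotallyAloof` — (H3) via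
  `thetaRayOfTwists_isTotallyEstranged_and_isTotallyAloof` (`ThetaRayEstranged`) with: infinitude and
  malnormality of `cl⟨a⟩`, `cl⟨a·b^{p^{n_k}}⟩` = brick R2a (`infinite_closure_zpowers_a/aMulPow`,
  `closure_zpowers_a_inf_conj_eq_bot`, `closure_zpowers_aMulPow_inf_conj_eq_bot'`, Nielsen basis — no cited
  fact), cross estrangement `cl⟨a⟩ ∩ g·cl⟨a·b^{p^{n_{k+1}}}⟩·g⁻¹ = 1` = brick R2b
  (`PadicInt.inf_conj_topologicalClosure_zpowers_mul_pow_prime_pow_eq_bot_of_exponential`, abelianisation,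
  `hinj` from the `ℤ_p`-exponential `α`).

Cell context (abc-iut, layer L3, FRONTIER programme SUBDAG-REFUTE-F1732, brick R5c, seat abc-iut-w6-d102): towards
a kernel erratum for the ∀-countable reading of [SemiAnbd] Thm 3.7 (iii) ([IUTchI] Rmk 2.5.3); desk countermodel
abc-iut-L3-d1 g3; print proves finite `𝔾` (kernel: p431007).  Nothing here bears on [IUTchIII] Cor. 3.12; no
named fact; typed ≠ proved. [cite: MochizukiSemiAnbd2006, Def 2.4 p.25-26]
-/

noncomputable section

namespace Literature.AnabelianGeometry.SemiGraphs

namespace ProfiniteSemiGraph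

open scoped Pointwise
open Topology Multiplicative
open Literature.AnabelianGeometry.SemiGraphs.FreeProPRankTwo
  (Grp ι a b ab isProSigmaCompletion_ι ab_a ab_b)

section FreeProP

variable (p : ℕ) [hp : Fact p.Prime]

/-- Uniqueness of continuous homomorphisms out of `ℤ_p` (multiplicative notation): two continuous
homomorphisms `Multiplicative ℤ_[p] → M` into a Hausdorff topological group agreeing at `ofAdd 1` are equal
(`ℤ` is dense in `ℤ_p`). [cite: MochizukiSemiAnbd2006, Def 2.1 p.22] -/
theorem ext_of_apply_ofAdd_one {M : Type*} [Group M] [TopologicalSpace M] [IsTopologicalGroup M] [T2Space M]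
    {f g : Multiplicative ℤ_[p] →* M} (hf : Continuous f) (hg : Continuous g)
    (h : f (ofAdd 1) = g (ofAdd 1)) : f = g := by
  -- the equaliser is a closed subgroup containing `⟨ofAdd 1⟩`, whose closure is everything
  have hle : (Subgroup.zpowers (ofAdd (1 : ℤ_[p]))).topologicalClosure ≤ f.eqLocus g :=
    (Subgroup.zpowers (ofAdd (1 : ℤ_[p]))).topologicalClosure_minimal
      ((Subgroup.zpowers_le).mpr h) (isClosed_eq hf hg)
  rw [PadicInt.topologicalClosure_zpowers_ofAdd_one, top_le_iff] at hle
  ext x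
  have hx : x ∈ f.eqLocus g := by rw [hle]; trivial
  exact hx

variable (α : Multiplicative ℤ_[p] →ₜ* Grp p) (hα1 : α (ofAdd 1) = a p)
variable (θ : ℕ → (Grp p →ₜ* Grp p)) (hθa : ∀ m, θ m (a p) = a p * b p ^ (p ^ m))
variable (n : ℕ → ℕ)

include hα1 in
/-- `ab ∘ α = (id, 0)`: the upper gluing reads `t ↦ (t, 0)` through the abelianisation.
[cite: MochizukiSemiAnbd2006, Def 2.1 p.22] -/
theorem ab_α (t : Multiplicative ℤ_[p]) : ab p (α t) = ofAdd (toAdd t, 0) := by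
  have key : (ab p).toMonoidHom.comp α.toMonoidHom =
      (AddMonoidHom.inl ℤ_[p] ℤ_[p]).toMultiplicative := by
    refine ext_of_apply_ofAdd_one p ((ab p).continuous.comp α.continuous)
      (continuous_ofAdd.comp (continuous_id.prodMk continuous_const |>.comp continuous_toAdd)) ?_
    show ab p (α (ofAdd 1)) = ofAdd ((1 : ℤ_[p]), (0 : ℤ_[p]))
    rw [hα1, ab_a]
  exact DFunLike.congr_fun key t

include hα1 hθa in
/-- `ab ∘ θ_m ∘ α = (id, p^m·id)`: the lower gluing `θ_m ∘ α` reads `t ↦ (t, p^m t)` through the abelianisation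
(`θ_m(a) = a·b^{p^m}` has `ab = (1, p^m)`). [cite: MochizukiSemiAnbd2006, Def 2.1 p.22] -/
theorem ab_θ_α (m : ℕ) (t : Multiplicative ℤ_[p]) :
    ab p (θ m (α t)) = ofAdd (toAdd t, (p : ℤ_[p]) ^ m * toAdd t) := by
  have key : (ab p).toMonoidHom.comp ((θ m).toMonoidHom.comp α.toMonoidHom) =
      ((AddMonoidHom.id ℤ_[p]).prod (AddMonoidHom.mulLeft ((p : ℤ_[p]) ^ m))).toMultiplicative := by
    refine ext_of_apply_ofAdd_one p ((ab p).continuous.comp ((θ m).continuous.comp α.continuous))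
      (continuous_ofAdd.comp ((continuous_id.prodMk (continuous_const.mul continuous_id)).comp
        continuous_toAdd)) ?_
    show ab p (θ m (α (ofAdd 1))) = ofAdd ((1 : ℤ_[p]), (p : ℤ_[p]) ^ m * 1)
    rw [hα1, hθa, map_mul, map_pow, ab_a, ab_b, mul_one]
    apply toAdd.injective
    rw [toAdd_mul, toAdd_pow, toAdd_ofAdd, toAdd_ofAdd, toAdd_ofAdd, Prod.smul_mk, Prod.mk_add_mk,
      smul_zero, add_zero, nsmul_eq_mul, mul_one, zero_add, Nat.cast_pow]
  exact DFunLike.congr_fun key t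

include hα1 hθa in
/-- **(H6) at the free pro-`p` model**: `𝒢_θ = thetaRayOfTwists F̂₂⁽ᵖ⁾ ℤ_p α θ n` is TOTALLY ELEVATED — no
binder but the gluing/twist equations (abelian level approximators; no Lazard).
[cite: MochizukiSemiAnbd2006, Def 2.4(i) p.25] -/
theorem thetaRayFreeProP_isTotallyElevated :
    (thetaRayOfTwists (Grp p) (Multiplicative ℤ_[p]) α θ n).IsTotallyElevated := by
  refine thetaRayOfTwists_isTotallyElevated α θ n p (ab p).toMonoidHom (ab p).continuous ?_
    (MonoidHom.id _) continuous_id Function.surjective_id (fun k => (p : ℤ_[p]) ^ n k) ?_ ?_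
  · exact surjective_of_ofAdd_one_zero_mem_of_ofAdd_zero_one_mem p (ab p).toMonoidHom (ab p).continuous
      ⟨a p, ab_a p⟩ ⟨b p, ab_b p⟩
  · intro t
    exact ab_α p α hα1 t
  · intro k t
    exact ab_θ_α p α hα1 θ hθa (n k) t

include hα1 hθa in
/-- **(H3) at the free pro-`p` model**: `𝒢_θ` is TOTALLY ESTRANGED and TOTALLY ALOOF — self terms from the
malnormality of `cl⟨a⟩`, `cl⟨a·b^{p^{n_k}}⟩` (brick R2a, Nielsen basis), cross terms from the abelianisation
(brick R2b) with `hinj` discharged by the `ℤ_p`-exponential `α`. [cite: MochizukiSemiAnbd2006, Def 2.4(iv) p.26] -/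
theorem thetaRayFreeProP_isTotallyEstranged_and_isTotallyAloof :
    (thetaRayOfTwists (Grp p) (Multiplicative ℤ_[p]) α θ n).IsTotallyEstranged ∧
      (thetaRayOfTwists (Grp p) (Multiplicative ℤ_[p]) α θ n).IsTotallyAloof := by
  have hι := isProSigmaCompletion_ι p
  have hprime : ∃ q ∈ ({p} : Set ℕ), q.Prime := ⟨p, rfl, hp.out⟩
  -- the lower generators: `θ_{n_k}(a) = a·b^{p^{n_k}} = ι (x₀ x₁^{p^{n_k}})`
  have hlow : ∀ k, θ (n k) (α (ofAdd 1)) = ι p (FreeGroup.of 0 * FreeGroup.of 1 ^ (p ^ n k)) := by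
    intro k
    rw [hα1, hθa, map_mul, map_pow]
    rfl
  have hup : α (ofAdd 1) = ι p (FreeGroup.of 0) := hα1
  refine thetaRayOfTwists_isTotallyEstranged_and_isTotallyAloof α θ n (ofAdd (1 : ℤ_[p]))
    PadicInt.topologicalClosure_zpowers_ofAdd_one ?_ ?_ ?_ ?_ ?_
  · -- `cl⟨a⟩` infinite
    rw [hup]; exact infinite_closure_zpowers_a hι hprime
  · -- `cl⟨a·b^{p^{n_k}}⟩` infinite
    intro k
    rw [hlow]
    have h := infinite_closure_zpowers_aMulPow hι hprime ((p ^ n k : ℕ) : ℤ)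
    rwa [zpow_natCast] at h
  · -- malnormality of `cl⟨a⟩`
    intro x hx
    rw [hup] at hx ⊢
    exact closure_zpowers_a_inf_conj_eq_bot hι hx
  · -- malnormality of `cl⟨a·b^{p^{n_k}}⟩`
    intro k x hx
    rw [hlow] at hx ⊢
    exact closure_zpowers_aMulPow_inf_conj_eq_bot' hι (p ^ n k) hx
  · -- the cross terms by abelianisation
    intro k g
    rw [hα1, hθa]
    have hrange : (Subgroup.zpowers (a p)).topologicalClosure ≤ α.toMonoidHom.range := by
      rw [MonoidHom.range_eq_topologicalClosure_zpowers_padicInt α.toMonoidHom α.continuous]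
      show (Subgroup.zpowers (a p)).topologicalClosure ≤ (Subgroup.zpowers (α (ofAdd 1))).topologicalClosure
      rw [hα1]
    exact FreeProPTwo.PadicInt.inf_conj_topologicalClosure_zpowers_mul_pow_prime_pow_eq_bot_of_exponential p
      (ab p).toMonoidHom (ab p).continuous (by show toAdd (ab p (a p)) = (1, 0); rw [ab_a]; rfl)
      (by show toAdd (ab p (b p)) = (0, 1); rw [ab_b]; rfl) α.toMonoidHom α.continuous hα1 hrange
      (n (k + 1)) g

include hα1 hθa in
/-- (H3), estranged half — binder `hTEs` of `thetaRayOfTwists_thm37Hypotheses`.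
[cite: MochizukiSemiAnbd2006, Def 2.4(iv) p.26] -/
theorem thetaRayFreeProP_isTotallyEstranged :
    (thetaRayOfTwists (Grp p) (Multiplicative ℤ_[p]) α θ n).IsTotallyEstranged :=
  (thetaRayFreeProP_isTotallyEstranged_and_isTotallyAloof p α hα1 θ hθa n).1

include hα1 hθa in
/-- (H3), aloof half — binder `hTA` of `thetaRayOfTwists_thm37Hypotheses`.
[cite: MochizukiSemiAnbd2006, Def 2.4(iv) p.26] -/
theorem thetaRayFreeProP_isTotallyAloof :
    (thetaRayOfTwists (Grp p) (Multiplicative ℤ_[p]) α θ n).IsTotallyAloof :=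
  (thetaRayFreeProP_isTotallyEstranged_and_isTotallyAloof p α hα1 θ hθa n).2

end FreeProP

/-! ### v2 (append-only, abc-iut-w6-d102): UNCONDITIONAL at brick R1c's gluing `α = zpow a` and Nielsen
twists `θₙ` (`FreeProPRankTwoGluing.lean`, abc-iut-L3-t7): (H3) and (H6) of [SemiAnbd] Thm 3.7 for the
concrete `𝒢_θ(p, n) := thetaRayOfTwists F̂₂⁽ᵖ⁾ ℤ_p α (θₘ)ₘ n` with NO hypothesis binder left. -/

section Concrete

open Literature.AnabelianGeometry.SemiGraphs.FreeProPRankTwo (θHom α_ofAdd_one θ_a θHom_apply)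

variable (p : ℕ) [hp : Fact p.Prime] (n : ℕ → ℕ)

/-- **(H6), UNCONDITIONAL**: the concrete countermodel candidate
`𝒢_θ(p, n) = thetaRayOfTwists F̂₂⁽ᵖ⁾ ℤ_p α θ n` (α = `FreeProPRankTwo.α p`, θₘ = `FreeProPRankTwo.θHom p m`)
is totally elevated, for EVERY exponent sequence `n`. [cite: MochizukiSemiAnbd2006, Def 2.4(i) p.25] -/
theorem thetaRayFreeProP_isTotallyElevated_concrete :
    (thetaRayOfTwists (Grp p) (Multiplicative ℤ_[p]) (FreeProPRankTwo.α p)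
      (fun m => θHom p m) n).IsTotallyElevated :=
  thetaRayFreeProP_isTotallyElevated p (FreeProPRankTwo.α p) (α_ofAdd_one p) (fun m => θHom p m)
    (fun m => by rw [θHom_apply, θ_a]) n

/-- **(H3), UNCONDITIONAL**: `𝒢_θ(p, n)` is totally estranged and totally aloof, for every `n`.
[cite: MochizukiSemiAnbd2006, Def 2.4(iv) p.26] -/
theorem thetaRayFreeProP_isTotallyEstranged_and_isTotallyAloof_concrete :
    (thetaRayOfTwists (Grp p) (Multiplicative ℤ_[p]) (FreeProPRankTwo.α p)
        (fun m => θHom p m) n).IsTotallyEstranged ∧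
      (thetaRayOfTwists (Grp p) (Multiplicative ℤ_[p]) (FreeProPRankTwo.α p)
        (fun m => θHom p m) n).IsTotallyAloof :=
  thetaRayFreeProP_isTotallyEstranged_and_isTotallyAloof p (FreeProPRankTwo.α p) (α_ofAdd_one p)
    (fun m => θHom p m) (fun m => by rw [θHom_apply, θ_a]) n

/-- (H3) estranged half, unconditional — the term for binder `hTEs` of `thetaRayOfTwists_thm37Hypotheses`.
[cite: MochizukiSemiAnbd2006, Def 2.4(iv) p.26] -/
theorem thetaRayFreeProP_isTotallyEstranged_concrete :
    (thetaRayOfTwists (Grp p) (Multiplicative ℤ_[p]) (FreeProPRankTwo.α p)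
      (fun m => θHom p m) n).IsTotallyEstranged :=
  (thetaRayFreeProP_isTotallyEstranged_and_isTotallyAloof_concrete p n).1

/-- (H3) aloof half, unconditional — the term for binder `hTA` of `thetaRayOfTwists_thm37Hypotheses`.
[cite: MochizukiSemiAnbd2006, Def 2.4(iv) p.26] -/
theorem thetaRayFreeProP_isTotallyAloof_concrete :
    (thetaRayOfTwists (Grp p) (Multiplicative ℤ_[p]) (FreeProPRankTwo.α p)
      (fun m => θHom p m) n).IsTotallyAloof :=
  (thetaRayFreeProP_isTotallyEstranged_and_isTotallyAloof_concrete p n).2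

end Concrete

end ProfiniteSemiGraph

end Literature.AnabelianGeometry.SemiGraphs

end
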